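import Mathlib
import Summits.Ventures.PercRepro2.Defs
import Summits.Ventures.PercRepro2.Independence
import Summits.Ventures.PercRepro2.Harris
import Summits.Ventures.PercRepro2.ThreeEventPrincipal
import Summits.Ventures.PercRepro2.ThreeEventSafe

/-!
# The cross term of the pinning step, the reduction of the three-event lemma to the cross inequality,
and the PRINCIPAL-H theorem (blind cell PercRepro2, p4 g33; proofs/P4-G33-CROSS.md §2–§3)

Pinning an edge `e` splits the covariance defect `Ψ_p = Cov_p(G, H) − Cov_p(M, B ∩ H)` as
`Ψ_p = a²·Ψ_{p[e↦1]} + (1 − a)²·Ψ_{p[e↦0]} + a(1 − a)·X_p(e)` with the CROSS TERM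
`X_p(e) := Ψ_{p[e↦0]} + Ψ_{p[e↦1]} + T_p(e)` (`T` the local term of `ThreeEventSafe`): `X` is the
contribution of the pairs of independent samples that DISAGREE on `e`, the two defects that of the
agreeing pairs. **`cov_inter_le_cov_of_cross`**: if every admissible weight vector with an unpinned
edge has an unpinned edge with `X_p(e) ≥ 0`, then `Cov_p(M, B ∩ H) ≤ Cov_p(G, H)` for every admissible
`p` — strictly weaker than the hypothesis (SAFE) of `cov_inter_le_cov_of_safe` (`T ≥ 0` is
`X ≥ Ψ₀ + Ψ₁`). `crossTerm_eq`: `X = Q(0,1) + Q(1,0)` in pinned probabilities (the G-sample at one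
level, the H-sample at the other).
**`defect_allOpen_nonneg` / `cov_inter_le_cov_allOpen`** (THEOREM, principal `H`): for increasing
`G, M` with `M ⊆ G`, `G ∩ B ⊆ M` and `B` decreasing, `Cov_p(M, B ∩ H) ≤ Cov_p(G, H)` whenever
`H = allOpen I` is the event that all edges of a set `I` are open. Induction on the number of unpinned
edges: an unpinned edge off `I` is safe (rule R1, `H` does not depend on it); for an unpinned edge
`e ∈ I` the cross term is `Q(0,1)` alone (`H` is null under `p[e↦0]`), and `Q(0,1)` dominates the
defect, under `p[e↦1]`, of the MIXED admissible instance `(restrictEvent {e} G, restrictEvent {e} M,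
H, B)` (the G-sample with `e` forced closed), which is nonnegative by the induction hypothesis.
No instance, no notation.
-/

namespace Summit.Ventures.PercRepro2

namespace ThreeEvent

section Cross

variable {E : Type*} [Fintype E] [DecidableEq E] {R : Type*} [CommRing R]

/-- The cross term of the pinning step: `X_p(e) = Ψ_{p[e↦0]} + Ψ_{p[e↦1]} + T_p(e)`. -/
noncomputable def crossTerm (p : E → R) (e : E) (G H M B : Set (Config E)) : R :=
  defect (Function.update p e 0) G H M B + defect (Function.update p e 1) G H M B
    + localTerm p e G H M B

/-- **The pinning identity with the cross term**:
`Ψ_p = a²·Ψ_{p[e↦1]} + (1 − a)²·Ψ_{p[e↦0]} + a(1 − a)·X_p(e)`. -/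
theorem defect_eq_pin_cross (p : E → R) (G H M B : Set (Config E)) (e : E) :
    defect p G H M B =
      p e ^ 2 * defect (Function.update p e 1) G H M B
        + (1 - p e) ^ 2 * defect (Function.update p e 0) G H M B
        + p e * (1 - p e) * crossTerm p e G H M B := by
  rw [defect_eq_pin p G H M B e]
  unfold crossTerm
  ring

/-- `X_p(e) = Q(0,1) + Q(1,0)`: the cross term in pinned probabilities, the H-sample at one level
and the G-sample at the other. -/
theorem crossTerm_eq (p : E → R) (e : E) (G H M B : Set (Config E)) :
    crossTerm p e G H M B =
      (prob (Function.update p e 1) (G ∩ H) - prob (Function.update p e 1) (M ∩ (B ∩ H))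
          - prob (Function.update p e 1) H * prob (Function.update p e 0) G
          + prob (Function.update p e 1) (B ∩ H) * prob (Function.update p e 0) M)
      + (prob (Function.update p e 0) (G ∩ H) - prob (Function.update p e 0) (M ∩ (B ∩ H))
          - prob (Function.update p e 0) H * prob (Function.update p e 1) G
          + prob (Function.update p e 0) (B ∩ H) * prob (Function.update p e 1) M) := by
  unfold crossTerm defect localTerm pinDelta
  ring

end Cross

section Induction

variable {E : Type*} [Fintype E] [DecidableEq E] {R : Type*} [CommRing R] [LinearOrder R]
  [IsStrictOrderedRing R]

/-- **The pinning induction with the cross term**: if every admissible weight vector with an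
unpinned edge has an unpinned edge `e` with `X_p(e) ≥ 0`, the defect is nonnegative for every
admissible weight vector. -/
theorem defect_nonneg_of_cross (G H M B : Set (Config E))
    (hcross : ∀ p : E → R, IsProbVec p → (unpinned p).Nonempty →
      ∃ e ∈ unpinned p, 0 ≤ crossTerm p e G H M B) :
    ∀ p : E → R, IsProbVec p → 0 ≤ defect p G H M B := by
  classical
  intro p hp
  induction hn : (unpinned p).card using Nat.strong_induction_on generalizing p with
  | _ n ih =>
    by_cases hne : (unpinned p).Nonempty
    · obtain ⟨e, he, hX⟩ := hcross p hp hne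
      have ha0 : 0 ≤ p e := hp.nonneg e
      have ha1 : 0 ≤ 1 - p e := sub_nonneg.2 (hp.le_one e)
      have hcard : ((unpinned p).erase e).card < n := by
        rw [← hn]; exact Finset.card_erase_lt_of_mem he
      have h1 : 0 ≤ defect (Function.update p e 1) G H M B :=
        ih _ hcard _ (hp.update e zero_le_one le_rfl) (by rw [unpinned_update p he 1 (Or.inr rfl)])
      have h0 : 0 ≤ defect (Function.update p e 0) G H M B :=
        ih _ hcard _ (hp.update e le_rfl zero_le_one) (by rw [unpinned_update p he 0 (Or.inl rfl)])
      rw [defect_eq_pin_cross p G H M B e]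
      have := mul_nonneg (mul_nonneg ha0 ha1) hX
      have := mul_nonneg (pow_nonneg ha0 2) h1
      have := mul_nonneg (pow_nonneg ha1 2) h0
      linarith
    · have hpin : ∀ e, p e = 0 ∨ p e = 1 := fun e => by
        by_contra hcon
        refine hne ⟨e, ?_⟩
        simp only [unpinned, Finset.mem_filter, Finset.mem_univ, true_and]
        exact ⟨fun h => hcon (Or.inl h), fun h => hcon (Or.inr h)⟩
      rw [defect_eq_zero_of_pinned p hpin]

/-- **A nonnegative cross term at every state suffices**: `Cov_p(M, B ∩ H) ≤ Cov_p(G, H)` for every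
admissible `p`, under the hypothesis (CROSS-∃) that every admissible weight vector with an unpinned
edge has an unpinned edge with nonnegative cross term. -/
theorem cov_inter_le_cov_of_cross (G H M B : Set (Config E))
    (hcross : ∀ p : E → R, IsProbVec p → (unpinned p).Nonempty →
      ∃ e ∈ unpinned p, 0 ≤ crossTerm p e G H M B)
    {p : E → R} (hp : IsProbVec p) :
    prob p (M ∩ (B ∩ H)) - prob p M * prob p (B ∩ H) ≤ prob p (G ∩ H) - prob p G * prob p H :=
  sub_nonneg.1 (defect_nonneg_of_cross G H M B hcross p hp)

end Induction

section PrincipalH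

variable {E : Type*} [Fintype E] [DecidableEq E] {R : Type*} [CommRing R]

omit [Fintype E] [DecidableEq E] in
/-- `allOpen I` is increasing. -/
lemma isUpperSet_allOpen' (I : Finset E) : IsUpperSet (allOpen I) := by
  intro ω ω' h hω e he
  have := h e
  rw [hω e he] at this
  exact Bool.eq_true_of_true_le this

omit [Fintype E] [DecidableEq E] in
/-- `allOpen I` is determined by the edges of `I`. -/
lemma dependsOn_allOpen (I : Finset E) : DependsOn (· ∈ allOpen I) (↑I : Set E) := by
  intro ω ω' h
  simp only [eq_iff_iff, mem_allOpen]
  constructor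
  · intro hω e he
    rw [← h e (by simpa using he)]
    exact hω e he
  · intro hω e he
    rw [h e (by simpa using he)]
    exact hω e he

/-- Under `p[e↦0]`, every event inside `allOpen I` is null when `e ∈ I`. -/
lemma prob_update_zero_inter_allOpen (p : E → R) (A : Set (Config E)) {I : Finset E} {e : E}
    (he : e ∈ I) : prob (Function.update p e 0) (A ∩ allOpen I) = 0 := by
  have hsub : A ∩ allOpen I = (A ∩ allOpen I) ∩ openEdge e := by
    ext ω
    constructor
    · intro hω
      exact ⟨hω, hω.2 e he⟩
    · intro hω
      exact hω.1
  rw [hsub]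
  exact prob_update_zero_inter_openEdge p (A ∩ allOpen I) e

/-- Pinning an edge open does not change the law of an event determined off that edge. -/
lemma prob_update_one_of_dependsOn_compl (p : E → R) {A : Set (Config E)} {e : E}
    (hA : DependsOn (· ∈ A) ((↑({e} : Finset E) : Set E)ᶜ)) :
    prob (Function.update p e 1) A = prob p A := by
  have h1 := prob_update_zero_of_dependsOn_compl (Function.update p e 1) hA
    (Finset.mem_singleton_self e)
  have h2 := prob_update_zero_of_dependsOn_compl p hA (Finset.mem_singleton_self e)
  rw [Function.update_idem] at h1
  rw [← h1, h2]

/-- `P_{p[e↦0]}(A) = P_{p[e↦1]}(restrictEvent {e} A)`: the law of `A` with `e` pinned closed is the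
law, with `e` pinned open, of «`A` with `e` forced closed». -/
lemma prob_update_zero_eq_prob_update_one_restrict (p : E → R) (A : Set (Config E)) (e : E) :
    prob (Function.update p e 0) A
      = prob (Function.update p e 1) (restrictEvent {e} A) := by
  have h0 : ∀ e' ∈ ({e} : Finset E), Function.update p e 0 e' = 0 := by
    intro e' he'
    rw [Finset.mem_singleton] at he'
    rw [he', Function.update_self]
  rw [prob_eq_prob_restrictEvent_of_pinned h0 A]
  have hdep := dependsOn_restrictEvent ({e} : Finset E) A
  rw [prob_update_zero_of_dependsOn_compl p hdep (Finset.mem_singleton_self e),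
    prob_update_one_of_dependsOn_compl p hdep]

omit [Fintype E] in
/-- `restrictEvent` is monotone in the event. -/
lemma restrictEvent_mono (F : Finset E) {A A' : Set (Config E)} (h : A ⊆ A') :
    restrictEvent F A ⊆ restrictEvent F A' := fun _ hω => h hω

omit [Fintype E] in
/-- If `G ∩ B ⊆ M` with `B` decreasing, the restricted events satisfy the same inclusion. -/
lemma restrictEvent_inter_subset {F : Finset E} {G M B : Set (Config E)} (hB : IsLowerSet B)
    (hGB : G ∩ B ⊆ M) : restrictEvent F G ∩ B ⊆ restrictEvent F M := by
  rintro ω ⟨hG, hBω⟩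
  exact hGB ⟨hG, hB (zeroOn_le F ω) hBω⟩

omit [Fintype E] [DecidableEq E] in
/-- Between `G ∩ B ⊆ M ⊆ G`, the events `M ∩ (B ∩ H)` and `G ∩ (B ∩ H)` coincide. -/
lemma inter_inter_eq_of_between {G M B H : Set (Config E)} (hMG : M ⊆ G) (hGB : G ∩ B ⊆ M) :
    M ∩ (B ∩ H) = G ∩ (B ∩ H) := by
  ext ω
  constructor
  · rintro ⟨hM, hBH⟩
    exact ⟨hMG hM, hBH⟩
  · rintro ⟨hG, hBH⟩
    exact ⟨hGB ⟨hG, hBH.1⟩, hBH⟩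

end PrincipalH

section PrincipalHMain

variable {E : Type*} [Fintype E] [DecidableEq E] {R : Type*} [CommRing R] [LinearOrder R]
  [IsStrictOrderedRing R]

/-- An unpinned edge off `I` is safe for `H = allOpen I` (rule R1: `Δ(B ∩ H) ≤ 0`). -/
lemma localTerm_allOpen_nonneg_of_notMem {p : E → R} (hp : IsProbVec p)
    {G M B : Set (Config E)} (hG : IsUpperSet G) (hM : IsUpperSet M) (hB : IsLowerSet B)
    {I : Finset E} {e : E} (he : e ∉ I) : 0 ≤ localTerm p e G (allOpen I) M B := by
  refine localTerm_nonneg_of_delta_inter_nonpos hp hG (isUpperSet_allOpen' I) hM e ?_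
  -- `Δ(B ∩ H) = ΔH − Δ(H ∖ B)`, `ΔH = 0` (`H` is determined off `e`), `Δ(H ∖ B) ≥ 0`.
  have hdep : DependsOn (· ∈ allOpen I) ((↑({e} : Finset E) : Set E)ᶜ) := by
    intro ω ω' h
    refine dependsOn_allOpen I fun i hi => h i ?_
    simp only [Finset.coe_singleton, Set.mem_compl_iff, Set.mem_singleton_iff]
    rintro rfl
    exact he hi
  have hH0 : pinDelta p e (allOpen I) = 0 := by
    unfold pinDelta
    rw [prob_update_one_of_dependsOn_compl p hdep,
      prob_update_zero_of_dependsOn_compl p hdep (Finset.mem_singleton_self e), sub_self]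
  have hsplit : ∀ q : E → R, prob q (allOpen I)
      = prob q (B ∩ allOpen I) + prob q (allOpen I \ B) := by
    intro q
    have := prob_inter_add_prob_inter_compl q (allOpen I) B
    rw [Set.inter_comm (allOpen I) B] at this
    rw [← this]
    rfl
  have hd : pinDelta p e (allOpen I)
      = pinDelta p e (B ∩ allOpen I) + pinDelta p e (allOpen I \ B) := by
    unfold pinDelta
    rw [hsplit (Function.update p e 1), hsplit (Function.update p e 0)]
    ring
  have hdiff := pinDelta_nonneg hp (isUpperSet_diff_of_isLowerSet (isUpperSet_allOpen' I) hB) e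
  linarith

/-- **The cross term at an edge of `I` is `Q(0,1)`, and `Q(0,1)` dominates the defect of the mixed
instance**: for `e ∈ I`, `X_p(e) ≥ Ψ_{p[e↦1]}(restrictEvent {e} G, allOpen I, restrictEvent {e} M, B)`. -/
lemma crossTerm_allOpen_ge {p : E → R} (hp : IsProbVec p) {G M B : Set (Config E)}
    (hG : IsUpperSet G) (hMG : M ⊆ G) (hGB : G ∩ B ⊆ M) (hB : IsLowerSet B)
    {I : Finset E} {e : E} (he : e ∈ I) :
    defect (Function.update p e 1) (restrictEvent {e} G) (allOpen I) (restrictEvent {e} M) B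
      ≤ crossTerm p e G (allOpen I) M B := by
  rw [crossTerm_eq]
  -- the level-0 terms vanish: `H` is null under `p[e↦0]`
  have hz : ∀ A : Set (Config E), prob (Function.update p e 0) (A ∩ allOpen I) = 0 :=
    fun A => prob_update_zero_inter_allOpen p A he
  have hH0 : prob (Function.update p e 0) (allOpen I) = 0 := by
    have := hz Set.univ
    rwa [Set.univ_inter] at this
  have hGH0 : prob (Function.update p e 0) (G ∩ allOpen I) = 0 := hz G
  have hMBH0 : prob (Function.update p e 0) (M ∩ (B ∩ allOpen I)) = 0 := by
    rw [← Set.inter_assoc]; exact hz (M ∩ B)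
  have hBH0 : prob (Function.update p e 0) (B ∩ allOpen I) = 0 := hz B
  rw [hGH0, hMBH0, hH0, hBH0]
  -- the level-0 laws of `G`, `M` are the level-1 laws of the restricted events
  rw [prob_update_zero_eq_prob_update_one_restrict p G e,
    prob_update_zero_eq_prob_update_one_restrict p M e]
  -- `M ∩ (B ∩ H) = G ∩ (B ∩ H)` on both the full and the restricted instance
  have hMG' : restrictEvent {e} M ⊆ restrictEvent {e} G := restrictEvent_mono _ hMG
  have hGB' : restrictEvent {e} G ∩ B ⊆ restrictEvent {e} M := restrictEvent_inter_subset hB hGB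
  unfold defect
  rw [inter_inter_eq_of_between hMG hGB, inter_inter_eq_of_between hMG' hGB']
  set q := Function.update p e 1 with hq
  have hq' : IsProbVec q := hp.update e zero_le_one le_rfl
  -- `G₀ ⊆ G`: the positive terms of `Q(0,1)` dominate those of the mixed instance
  have hsub : restrictEvent {e} G ⊆ G := restrictEvent_subset _ hG
  have h1 : prob q (G ∩ allOpen I)
      = prob q (restrictEvent {e} G ∩ allOpen I)
        + prob q ((G ∩ allOpen I) ∩ (restrictEvent {e} G)ᶜ) := by
    have := prob_inter_add_prob_inter_compl q (G ∩ allOpen I) (restrictEvent {e} G)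
    rw [← this]
    congr 2
    ext ω
    constructor
    · rintro ⟨⟨_, hH⟩, hr⟩; exact ⟨hr, hH⟩
    · rintro ⟨hr, hH⟩; exact ⟨⟨hsub hr, hH⟩, hr⟩
  have h2 : prob q (G ∩ (B ∩ allOpen I))
      = prob q (restrictEvent {e} G ∩ (B ∩ allOpen I))
        + prob q ((G ∩ (B ∩ allOpen I)) ∩ (restrictEvent {e} G)ᶜ) := by
    have := prob_inter_add_prob_inter_compl q (G ∩ (B ∩ allOpen I)) (restrictEvent {e} G)
    rw [← this]
    congr 2
    ext ω
    constructor
    · rintro ⟨⟨_, hBH⟩, hr⟩; exact ⟨hr, hBH⟩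
    · rintro ⟨hr, hBH⟩; exact ⟨⟨hsub hr, hBH⟩, hr⟩
  have h3 : prob q ((G ∩ (B ∩ allOpen I)) ∩ (restrictEvent {e} G)ᶜ)
      ≤ prob q ((G ∩ allOpen I) ∩ (restrictEvent {e} G)ᶜ) := by
    refine prob_mono hq' ?_
    rintro ω ⟨⟨hGω, _, hH⟩, hr⟩
    exact ⟨⟨hGω, hH⟩, hr⟩
  rw [h1, h2]
  linarith

/-- **Principal `H` (THEOREM, defect form)**: for increasing `G, M` with `M ⊆ G`, `G ∩ B ⊆ M` and `B`
decreasing, the defect with `H = allOpen I` is nonnegative for every admissible weight vector. -/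
theorem defect_allOpen_nonneg :
    ∀ (n : ℕ) (p : E → R), IsProbVec p → (unpinned p).card = n →
      ∀ (G M B : Set (Config E)) (I : Finset E), IsUpperSet G → IsUpperSet M → M ⊆ G →
        G ∩ B ⊆ M → IsLowerSet B → 0 ≤ defect p G (allOpen I) M B := by
  classical
  intro n
  induction n using Nat.strong_induction_on with
  | _ n ih =>
    intro p hp hn G M B I hG hM hMG hGB hB
    by_cases hne : (unpinned p).Nonempty
    · obtain ⟨e, he⟩ := hne
      have ha0 : 0 ≤ p e := hp.nonneg e
      have ha1 : 0 ≤ 1 - p e := sub_nonneg.2 (hp.le_one e)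
      have hcard : ((unpinned p).erase e).card < n := by
        rw [← hn]; exact Finset.card_erase_lt_of_mem he
      have hp1 : IsProbVec (Function.update p e 1) := hp.update e zero_le_one le_rfl
      have hp0 : IsProbVec (Function.update p e 0) := hp.update e le_rfl zero_le_one
      have hc1 : (unpinned (Function.update p e 1)).card = ((unpinned p).erase e).card := by
        rw [unpinned_update p he 1 (Or.inr rfl)]
      have hc0 : (unpinned (Function.update p e 0)).card = ((unpinned p).erase e).card := by
        rw [unpinned_update p he 0 (Or.inl rfl)]
      have h1 : 0 ≤ defect (Function.update p e 1) G (allOpen I) M B :=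
        ih _ hcard _ hp1 hc1 G M B I hG hM hMG hGB hB
      have h0 : 0 ≤ defect (Function.update p e 0) G (allOpen I) M B :=
        ih _ hcard _ hp0 hc0 G M B I hG hM hMG hGB hB
      by_cases heI : e ∈ I
      · -- an edge of `I`: the cross term dominates the mixed instance
        have hmixed : 0 ≤ defect (Function.update p e 1) (restrictEvent {e} G) (allOpen I)
            (restrictEvent {e} M) B :=
          ih _ hcard _ hp1 hc1 _ _ B I (isUpperSet_restrictEvent _ hG) (isUpperSet_restrictEvent _ hM)
            (restrictEvent_mono _ hMG) (restrictEvent_inter_subset hB hGB) hB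
        have hX : 0 ≤ crossTerm p e G (allOpen I) M B :=
          hmixed.trans (crossTerm_allOpen_ge hp hG hMG hGB hB heI)
        rw [defect_eq_pin_cross p G (allOpen I) M B e]
        have := mul_nonneg (mul_nonneg ha0 ha1) hX
        have := mul_nonneg (pow_nonneg ha0 2) h1
        have := mul_nonneg (pow_nonneg ha1 2) h0
        linarith
      · -- an edge off `I`: safe by rule R1
        have hT : 0 ≤ localTerm p e G (allOpen I) M B :=
          localTerm_allOpen_nonneg_of_notMem hp hG hM hB heI
        rw [defect_eq_pin p G (allOpen I) M B e]
        have := mul_nonneg (mul_nonneg ha0 ha1) hT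
        have := mul_nonneg ha0 h1
        have := mul_nonneg ha1 h0
        linarith
    · have hpin : ∀ e, p e = 0 ∨ p e = 1 := fun e => by
        by_contra hcon
        refine hne ⟨e, ?_⟩
        simp only [unpinned, Finset.mem_filter, Finset.mem_univ, true_and]
        exact ⟨fun h => hcon (Or.inl h), fun h => hcon (Or.inr h)⟩
      rw [defect_eq_zero_of_pinned p hpin]

/-- **Principal `H` (THEOREM)**: `Cov_p(M, B ∩ H) ≤ Cov_p(G, H)` for `H = allOpen I` (all edges of
`I` open, i.e. `H = ↑h` principal), increasing `G, M` with `M ⊆ G` and `G ∩ B ⊆ M`, and `B`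
decreasing — in particular for `M = ↑(G ∩ B)`. -/
theorem cov_inter_le_cov_allOpen {p : E → R} (hp : IsProbVec p) {G M B : Set (Config E)}
    (hG : IsUpperSet G) (hM : IsUpperSet M) (hMG : M ⊆ G) (hGB : G ∩ B ⊆ M) (hB : IsLowerSet B)
    (I : Finset E) :
    prob p (M ∩ (B ∩ allOpen I)) - prob p M * prob p (B ∩ allOpen I)
      ≤ prob p (G ∩ allOpen I) - prob p G * prob p (allOpen I) :=
  sub_nonneg.1 (defect_allOpen_nonneg _ p hp rfl G M B I hG hM hMG hGB hB)

/-- **Principal `H`, the minimal `M = ↑(G ∩ B)`**: `Cov_p(↑(G ∩ B), B ∩ allOpen I) ≤ Cov_p(G, allOpen I)`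
for increasing `G` and decreasing `B`. -/
theorem cov_inter_le_cov_allOpen' {p : E → R} (hp : IsProbVec p) {G B : Set (Config E)}
    (hG : IsUpperSet G) (hB : IsLowerSet B) (I : Finset E) :
    prob p ({ω | ∃ z ∈ G, z ∈ B ∧ z ≤ ω} ∩ (B ∩ allOpen I))
        - prob p {ω | ∃ z ∈ G, z ∈ B ∧ z ≤ ω} * prob p (B ∩ allOpen I)
      ≤ prob p (G ∩ allOpen I) - prob p G * prob p (allOpen I) := by
  refine cov_inter_le_cov_allOpen hp hG ?_ ?_ ?_ hB I
  · rintro ω ω' h ⟨z, hzG, hzB, hz⟩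
    exact ⟨z, hzG, hzB, hz.trans h⟩
  · rintro ω ⟨z, hzG, _, hz⟩
    exact hG hz hzG
  · rintro ω ⟨hωG, hωB⟩
    exact ⟨ω, hωG, hωB, le_rfl⟩

end PrincipalHMain

end ThreeEvent

end Summit.Ventures.PercRepro2
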